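import Mathlib

/-!
# SoloBlindMonomialRigidity — the finite rigidity step of cyclic automorphic-induction descent

Solo seat `solo-Langlands-blind` (blind mode), session 2.  Pure finite combinatorics over `ZMod q`,
`q` prime; it is Lemma 3 of this seat's descent theorem (paper/descent.md): in the descent of an
ℓ-adic Galois representation along a cyclic automorphic induction of prime degree `p`, the twisting
character attached to each irreducible slot is a character of `μ_q^{p-1}` whose value at every
*generic* vector `ζ⃗` lies in `{1, ζ_1, …, ζ_{p-1}}`; the theorem below (written additively, `m = p - 1`)
says such a character is trivial or a coordinate as soon as `q` is large:
if `e : Fin m → ZMod q` satisfies `∑ i, e i * x i ∈ {0, x 0, …}` for every `x` with nonzero pairwise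
distinct coordinates and `(m+1) * q^(m-1) < (q-m)^m`, then `e = 0` or `e = Pi.single i 1`.
The numerical hypothesis holds for every prime `q > (m+1)^2 + m`; some largeness is needed
(`q = 5, m = 2, e = (2,2)` satisfies the hypothesis of the theorem except the inequality).
-/

namespace Summit.Langlands.Langlands.Theorems
namespace SoloBlind

open Finset

section MonomialRigidity

variable {q m : ℕ}

variable [Fact q.Prime]

/-- A hyperplane `{x | ∑ c i * x i = 0}` with `c ≠ 0` in `(ZMod q)^m` has at most `q^(m-1)` points. -/
theorem card_filter_sum_mul_eq_zero_le (c : Fin m → ZMod q) (hc : c ≠ 0) :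
    (univ.filter fun x : Fin m → ZMod q => ∑ i, c i * x i = 0).card ≤ q ^ (m - 1) := by
  obtain ⟨i₀, hi₀⟩ : ∃ i₀, c i₀ ≠ 0 := by
    by_contra h
    apply hc
    funext i
    by_contra hi
    exact h ⟨i, hi⟩
  obtain ⟨m', rfl⟩ : ∃ m', m = m' + 1 := ⟨m - 1, by have := i₀.pos; omega⟩
  -- restriction to the coordinates other than `i₀`
  let r : (Fin (m' + 1) → ZMod q) → (Fin m' → ZMod q) := fun x j => x (i₀.succAbove j)
  have hinj : Set.InjOn r ↑(univ.filter fun x : Fin (m' + 1) → ZMod q => ∑ i, c i * x i = 0) := by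
    intro x hx y hy hxy
    simp only [coe_filter, mem_univ, true_and, Set.mem_setOf_eq] at hx hy
    have hoff : ∀ i, i ≠ i₀ → x i = y i := by
      intro i hi
      obtain ⟨j, rfl⟩ := Fin.exists_succAbove_eq hi
      exact congrFun hxy j
    funext i
    by_cases hi : i = i₀
    · subst hi
      have hx' : c i * x i = -∑ j ∈ univ.erase i, c j * x j := by
        rw [← Finset.add_sum_erase _ _ (mem_univ i)] at hx
        linear_combination hx
      have hy' : c i * y i = -∑ j ∈ univ.erase i, c j * y j := by
        rw [← Finset.add_sum_erase _ _ (mem_univ i)] at hy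
        linear_combination hy
      have hsum : ∑ j ∈ univ.erase i, c j * x j = ∑ j ∈ univ.erase i, c j * y j := by
        refine Finset.sum_congr rfl fun j hj => ?_
        rw [hoff j (Finset.ne_of_mem_erase hj)]
      have hmul : c i * x i = c i * y i := by rw [hx', hy', hsum]
      exact mul_left_cancel₀ hi₀ hmul
    · exact hoff i hi
  calc (univ.filter fun x : Fin (m' + 1) → ZMod q => ∑ i, c i * x i = 0).card
      ≤ (univ : Finset (Fin m' → ZMod q)).card :=
        Finset.card_le_card_of_injOn r (fun _ _ => mem_univ _) hinj
    _ = q ^ (m' + 1 - 1) := by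
        simp [Finset.card_univ, ZMod.card, Fintype.card_fin]

/-- The set of vectors with nonzero pairwise distinct coordinates has at least `(q - m)^m` elements. -/
theorem pow_sub_le_card_generic :
    (q - m) ^ m ≤ (univ.filter fun x : Fin m → ZMod q =>
      (∀ i, x i ≠ 0) ∧ Function.Injective x).card := by
  -- inject embeddings `Fin m ↪ {a // a ≠ 0}` into the generic set
  let Φ : (Fin m ↪ {a : ZMod q // a ≠ 0}) → (Fin m → ZMod q) := fun f i => (f i).1
  have hmem : ∀ f ∈ (univ : Finset (Fin m ↪ {a : ZMod q // a ≠ 0})),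
      Φ f ∈ (univ.filter fun x : Fin m → ZMod q => (∀ i, x i ≠ 0) ∧ Function.Injective x) := by
    intro f _
    simp only [mem_filter, mem_univ, true_and]
    exact ⟨fun i => (f i).2, fun i j hij => f.injective (Subtype.ext hij)⟩
  have hinj : Set.InjOn Φ ↑(univ : Finset (Fin m ↪ {a : ZMod q // a ≠ 0})) := by
    intro f _ g _ hfg
    ext i
    exact congrArg (fun v => v) (congrFun hfg i)
  have hq1 : 1 ≤ q := (Fact.out : q.Prime).one_lt.le
  calc (q - m) ^ m = (q - 1 + 1 - m) ^ m := by rw [Nat.sub_add_cancel hq1]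
    _ ≤ (q - 1).descFactorial m := Nat.pow_sub_le_descFactorial (q - 1) m
    _ = (univ : Finset (Fin m ↪ {a : ZMod q // a ≠ 0})).card := by
        rw [Finset.card_univ, Fintype.card_embedding_eq, Fintype.card_fin,
          Fintype.card_congr (unitsEquivNeZero (G₀ := ZMod q)).symm, ZMod.card_units q]
    _ ≤ (univ.filter fun x : Fin m → ZMod q => (∀ i, x i ≠ 0) ∧ Function.Injective x).card :=
        Finset.card_le_card_of_injOn Φ hmem hinj

/-- **Monomial rigidity** (Lemma 3 of the cyclic AI-descent): if the linear form `∑ e i * x i`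
takes, at every `x` with nonzero pairwise distinct coordinates, one of the values
`0, x 0, …, x (m-1)`, and `(m+1) * q^(m-1) < (q-m)^m`, then `e = 0` or `e` is a standard basis
vector. -/
theorem monomialRigidity (hcount : (m + 1) * q ^ (m - 1) < (q - m) ^ m)
    (e : Fin m → ZMod q)
    (he : ∀ x : Fin m → ZMod q, ((∀ i, x i ≠ 0) ∧ Function.Injective x) →
      (∑ i, e i * x i = 0 ∨ ∃ i, ∑ j, e j * x j = x i)) :
    e = 0 ∨ ∃ i, e = Pi.single i 1 := by
  by_contra hne
  have he0 : e ≠ 0 := fun h => hne (Or.inl h)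
  have hei : ∀ i, e ≠ Pi.single i 1 := fun i h => hne (Or.inr ⟨i, h⟩)
  -- the shifted coefficient vectors `e - δ_i`
  let c : Fin m → Fin m → ZMod q := fun i => e - Pi.single i 1
  have hc : ∀ i, c i ≠ 0 := fun i => sub_ne_zero.mpr (hei i)
  have hkey : ∀ (i : Fin m) (x : Fin m → ZMod q), ∑ j, c i j * x j = ∑ j, e j * x j - x i := by
    intro i x
    simp only [c, Pi.sub_apply, sub_mul, Finset.sum_sub_distrib, Pi.single_apply, ite_mul,
      one_mul, zero_mul, Finset.sum_ite_eq', Finset.mem_univ, if_true]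
  have hAcard : (univ.filter fun x : Fin m → ZMod q => ∑ i, e i * x i = 0).card ≤ q ^ (m - 1) :=
    card_filter_sum_mul_eq_zero_le e he0
  have hBcard : ∀ i, (univ.filter fun x : Fin m → ZMod q => ∑ j, c i j * x j = 0).card
      ≤ q ^ (m - 1) := fun i => card_filter_sum_mul_eq_zero_le (c i) (hc i)
  -- the generic set is covered by the `m + 1` hyperplanes
  have hcover : (univ.filter fun x : Fin m → ZMod q => (∀ i, x i ≠ 0) ∧ Function.Injective x)
      ⊆ (univ.filter fun x : Fin m → ZMod q => ∑ i, e i * x i = 0) ∪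
        univ.biUnion (fun i => univ.filter fun x : Fin m → ZMod q => ∑ j, c i j * x j = 0) := by
    intro x hx
    simp only [mem_filter, mem_univ, true_and] at hx
    rcases he x hx with h0 | ⟨i, hi⟩
    · apply mem_union_left
      simp only [mem_filter, mem_univ, true_and]
      exact h0
    · apply mem_union_right
      rw [mem_biUnion]
      refine ⟨i, mem_univ _, ?_⟩
      simp only [mem_filter, mem_univ, true_and]
      rw [hkey, hi, sub_self]
  have hup : (univ.filter fun x : Fin m → ZMod q => (∀ i, x i ≠ 0) ∧ Function.Injective x).card
      ≤ (m + 1) * q ^ (m - 1) := by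
    calc (univ.filter fun x : Fin m → ZMod q => (∀ i, x i ≠ 0) ∧ Function.Injective x).card
        ≤ ((univ.filter fun x : Fin m → ZMod q => ∑ i, e i * x i = 0) ∪
            univ.biUnion (fun i => univ.filter fun x : Fin m → ZMod q =>
              ∑ j, c i j * x j = 0)).card := card_le_card hcover
      _ ≤ (univ.filter fun x : Fin m → ZMod q => ∑ i, e i * x i = 0).card +
            (univ.biUnion (fun i => univ.filter fun x : Fin m → ZMod q =>
              ∑ j, c i j * x j = 0)).card := card_union_le _ _
      _ ≤ q ^ (m - 1) + ∑ i : Fin m, (univ.filter fun x : Fin m → ZMod q =>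
              ∑ j, c i j * x j = 0).card := Nat.add_le_add hAcard card_biUnion_le
      _ ≤ q ^ (m - 1) + ∑ _i : Fin m, q ^ (m - 1) :=
            Nat.add_le_add_left (sum_le_sum fun i _ => hBcard i) _
      _ = (m + 1) * q ^ (m - 1) := by
            rw [Finset.sum_const, Finset.card_univ, Fintype.card_fin, smul_eq_mul]
            ring
  have hlow : (q - m) ^ m ≤
      (univ.filter fun x : Fin m → ZMod q => (∀ i, x i ≠ 0) ∧ Function.Injective x).card :=
    pow_sub_le_card_generic
  exact lt_irrefl _ (lt_of_le_of_lt (hlow.trans hup) hcount)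

end MonomialRigidity

end SoloBlind
end Summit.Langlands.Langlands.Theorems
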